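import Summits.ABC.ABC.Theorems.IUTThetaPilotThetaPartIIOfChildren
import Summits.ABC.ABC.Theorems.IUTThetaPilotThetaPartIIStubHullVolumePerImage
import HarnessLib

/-!
# Route `IUTThetaPilot`, crux `ThetaPartII` (stmt-ABC-19678), display-P line: the crux — and `ABC` given
# `GenEllTwo` — from the ONE remaining stub `stub_cor312PerImage` ([IUTchIII] Cor. 3.12 read per image)

Mochizuki, *Inter-universal Teichmüller theory IV*, RIMS manuscript (Apr. 2020; = PRIMS **57** (2021)), Thm. 1.10
(pp. 22–31), Cor. 2.2 (ii) (pp. 41–48), Cor. 2.3 (pp. 49–55); [IUTchIII] Cor. 3.12 (kurims p. 174), Step (x) (p. 181).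

The registered UNION skeleton of the crux `Summit.ABC.ABC.Theses.IUTThetaPilot.ThetaPartII` (abc-iut-c312-8, sha16
76b99b29aaa7c8f6) has, on its display-P line (abc-iut-S7's per-image reading of `−|log(Θ)|`, abc-iut-plan R-g8-1/R-g8-4),
three children: (i) `stub_thetaData` — a THEOREM (`ThetaPartII.stub_thetaData`, abc-iut-L5-t7 over abc-iut-S2's
`ThetaGeometryInhabited`); (ii′-P) `stub_hullVolumePerImage` — a THEOREM (`ThetaPartII.stub_hullVolumePerImage`,
abc-iut-c312-d1 over abc-iut-S3's pinned junction, abc-iut-S1's (R4) at the datum, abc-iut-S7's per-image Step (v));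
(iii-P) `stub_cor312PerImage` — [IUTchIII] Cor. 3.12 read per image at every genuine Θ-volume datum: THE crux content,
CLAIM form, DISPUTED in print (Scholze–Stix 2018), never asserted.

So, on this line, the crux is kernel-reduced to (iii-P) ALONE:
* **`ThetaPartII_of_cor312PerImage : stub_cor312PerImage → ThetaPartII`** (abc-iut-S2's
  `ThetaPartII_of_cor312PerImage_of_hullVolumePerImage` with (ii′-P) discharged by name);
* **`ABC_of_cor312PerImage_of_genEllTwo : stub_cor312PerImage → GenEllTwo → ABC`** (through the route's certified
  deciding theorem `closes` and the proved support `JInvWlog_proof`).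
Every other input of the chain [IUTchIII] Cor. 3.12 ⟹ [IUTchIV] Thm. 1.10 ⟹ Cor. 2.2 ⟹ Cor. 2.3 is a THEOREM of the
tree; the remaining named input beside (iii-P) is the support item `GenEllTwo` ([GenEll] Thm. 2.1 at `Σ = {2}`,
classical). CONDITIONAL (`proof.conditional`); the crux item stays OPEN; nothing here asserts abc, Thm. 1.10 or
Cor. 3.12, or takes a side on the dispute or on the (U)/(P) reading question (the union line's analogue needs
`stub_hullVolume`, open off slot-constant data — plan VERDICT RISK ¶7).
-/

set_option linter.dupNamespace false

noncomputable section

namespace Summit.ABC.ABC.Theorems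

open Literature.NumberTheory.DiophantineGeometry.GenEll Literature.IUT.LogVolume

/-- **The crux `ThetaPartII` from [IUTchIII] Cor. 3.12 (per-image reading) at the Θ-data of the `λ`-line ALONE**
(display-P line; children (i) and (ii′-P) are theorems). CONDITIONAL; does not close the item.
[cite: Mochizuki2012, IUTchIV Cor. 2.2 (ii) pp.41–48] [claim: Mochizuki2012, status: disputed] -/
theorem ThetaPartII_of_cor312PerImage
    (h312 : ∀ P : NFPoint, P ∈ UP → ∀ l : ℕ, l.Prime → 5 ≤ l →
      Cor22.AdmitsCore P → Cor22.CondP2 P l → Cor22.CondP5 P l → Cor22.CondP6 P l →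
        Cor22.Cor312PerImageAtDatum P l) :
    Summit.ABC.ABC.Theses.IUTThetaPilot.ThetaPartII :=
  ThetaPartII_of_cor312PerImage_of_hullVolumePerImage h312 ThetaPartII.stub_hullVolumePerImage

/-- **`ABC` from [IUTchIII] Cor. 3.12 (per-image reading) at the Θ-data of the `λ`-line and [GenEll] Thm. 2.1 at
`Σ = {2}`** — the campaign-S shape of the IUT route on the display-P line: every other link is a theorem of the tree.
CONDITIONAL; nothing asserted; no side taken. [cite: Mochizuki2012, IUTchIV Cor. 2.2–2.3 pp.41–55]
[claim: Mochizuki2012, status: disputed] -/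
theorem ABC_of_cor312PerImage_of_genEllTwo
    (h312 : ∀ P : NFPoint, P ∈ UP → ∀ l : ℕ, l.Prime → 5 ≤ l →
      Cor22.AdmitsCore P → Cor22.CondP2 P l → Cor22.CondP5 P l → Cor22.CondP6 P l →
        Cor22.Cor312PerImageAtDatum P l)
    (hG : Summit.ABC.ABC.Theses.IUTThetaPilot.GenEllTwo) : _root_.ABC :=
  Summit.ABC.ABC.Theses.IUTThetaPilot.closes (ThetaPartII_of_cor312PerImage h312) hG JInvWlog_proof

end Summit.ABC.ABC.Theorems

end
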